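import Mathlib
import HarnessLib
import Summits.QuantumFields.YangMills.Theorems.MirrorModularBoostsHypercubicLimitCouplingResponseDefsC
import Summits.QuantumFields.YangMills.Theorems.PencilRigidityCurvatureKernelBoundLatticeTruncatedTwoPointBound
import Literature.MathematicalPhysics.QuantumFieldTheory.SpeciesLatticeSupBounds
import Literature.MathematicalPhysics.QuantumFieldTheory.LatticeGaugeProofs
import Summits.QuantumFields.YangMills.Theorems.LangevinControlUVOSLegsFromFemtoAndGapStubLowerBump
import Summits.QuantumFields.YangMills.Theorems.MirrorModularBoostsHypercubicLimitPlaneDistDisjointProductBound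

/-!
# `WeakCouplingHypercubicLimit` — stub `stub_countertermBound` (line `Sketch`, reshape r11)

Crux `stmt-QuantumFields-16120` (`PencilRigidity.WeakCouplingHypercubicLimit`), line `Sketch`
(`trace-norm-cold-pressure`), stub `stub_countertermBound` (M): **the additive counterterms of the
curvature are bounded**, `∃ Cm, ∀ k, |m_k| ≤ Cm`, given the `k`-uniform plane-resolved moment bounds
`UniformMomentBoundsPlanes r sch` and the non-triviality floor
`δ ≤ |LS₂(u, v) − LS₁(u) LS₁(v)|` eventually in `k`.

Route.
1. NT + the truncated two-point bound (`CurvatureKernel.LatticeTruncatedTwoPointBound`) and the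
   mesh-uniform Riemann bounds `a_k⁴ Σ |u(a_k x)| ≤ Cu` (`exists_latticeSum_le`) give
   `δ ≤ c_k² D`, `D = (2B_c)² Cu Cv`, eventually; hence `D > 0` and `|c_k| ≥ √(δ/D) > 0` eventually.
2. UMBP at `n = 1` on the tuple supported on one plane `q₀` with the normalised bump `f = t f₀`
   (`f₀ = 1` on the unit ball, `0 ≤ f₀`, `t = 1/(1 + |f₀|_s)`) gives `|∫ Φ^{q₀}_k(f) dμ_k| ≤ C₀ C₁`.
3. `∫ Φ^{q₀}_k(f) dμ_k = c_k a_k⁴ Σ_x f(a_k x) ξ_x` with `ξ_x = ∫ (W(τ₋ₓŨ) − m_k/6) dμ_k`,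
   `|ξ_x + m_k/6| ≤ B_w`; since `f ≥ 0`, `(|m_k/6| − B_w) Σ_x f(a_k x) ≤ |Σ_x f(a_k x) ξ_x|`, so
   `|c_k| R_k (|m_k/6| − B_w) ≤ C₀ C₁` with `R_k = a_k⁴ Σ_x f(a_k x)`.
4. Counting lattice points of the plateau (`pow_le_sum_box`): `R_k ≥ t/16` once `2a_k ≤ 1 ≤ a_k L_k`.
5. Hence eventually `|m_k| ≤ 6 (B_w + C₀C₁ / (√(δ/D) t/16))`; finitely many earlier `k` are absorbed.
[folklore]
-/

noncomputable section

open scoped SchwartzMap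
open MeasureTheory Filter Topology
open Literature.MathematicalPhysics.AQFT Literature.MathematicalPhysics.QuantumLattice
  Literature.MathematicalPhysics.QuantumFieldTheory
open Literature.Probability.LatticeModels (Site box mem_box)
open Summit.QuantumFields.YangMills.Cruxes.HypercubicLimit.CouplingResponse
open Summit.QuantumFields.YangMills.Theorems.CurvatureKernel
  (LatticeTruncatedTwoPointBound abs_integral_le_of_abs_le)
open Summit.QuantumFields.YangMills.Theorems.StrongCouplingIRTrivial.TwoPoint (integrable_shift_lift)
open Summit.QuantumFields.YangMills.Theorems.OSLegsFromFemtoAndGap.StubLower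
  (pow_le_sum_box exists_bump_schwartz)

namespace Summit.QuantumFields.YangMills.Theorems.WeakCouplingHypercubicLimit.TraceNormColdPressure

/-! ## Two real-variable helpers -/

/-- **Sign/triangle lemma.** If `p ≥ 0` on `s` and `|ξ_x + M| ≤ B` on `s`, then
`(|M| − B) Σ p ≤ |Σ p ξ|` (write `Σ p ξ = Σ p (ξ + M) − M Σ p`). [folklore] -/
theorem sub_mul_sum_le_abs_sum_mul {α : Type*} (s : Finset α) (p ξ : α → ℝ) (M B : ℝ)
    (hp : ∀ x ∈ s, 0 ≤ p x) (hξ : ∀ x ∈ s, |ξ x + M| ≤ B) :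
    (|M| - B) * ∑ x ∈ s, p x ≤ |∑ x ∈ s, p x * ξ x| := by
  have hS : 0 ≤ ∑ x ∈ s, p x := Finset.sum_nonneg hp
  have h1 : ∑ x ∈ s, p x * ξ x = ∑ x ∈ s, p x * (ξ x + M) - M * ∑ x ∈ s, p x := by
    rw [Finset.mul_sum, ← Finset.sum_sub_distrib]
    exact Finset.sum_congr rfl fun x _ => by ring
  have h2 : |∑ x ∈ s, p x * (ξ x + M)| ≤ B * ∑ x ∈ s, p x := by
    rw [Finset.mul_sum]
    refine (Finset.abs_sum_le_sum_abs _ _).trans (Finset.sum_le_sum fun x hx => ?_)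
    rw [abs_mul, abs_of_nonneg (hp x hx), mul_comm]
    exact mul_le_mul_of_nonneg_right (hξ x hx) (hp x hx)
  have h3 : |M * ∑ x ∈ s, p x| = |M| * ∑ x ∈ s, p x := by
    rw [abs_mul, abs_of_nonneg hS]
  have h4 : |M * ∑ x ∈ s, p x| - |∑ x ∈ s, p x * (ξ x + M)| ≤
      |∑ x ∈ s, p x * (ξ x + M) - M * ∑ x ∈ s, p x| := by
    rw [abs_sub_comm]; exact abs_sub_abs_le_abs_sub _ _
  rw [h1]
  calc (|M| - B) * ∑ x ∈ s, p x = |M| * ∑ x ∈ s, p x - B * ∑ x ∈ s, p x := by ring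
    _ ≤ |M * ∑ x ∈ s, p x| - |∑ x ∈ s, p x * (ξ x + M)| := by rw [h3]; linarith
    _ ≤ _ := h4

/-- An eventually bounded real sequence is bounded. [folklore] -/
theorem exists_forall_abs_le_of_eventually {m : ℕ → ℝ} {C : ℝ} (h : ∀ᶠ k in atTop, |m k| ≤ C) :
    ∃ Cm : ℝ, ∀ k, |m k| ≤ Cm := by
  obtain ⟨K₀, hK₀⟩ := eventually_atTop.1 h
  refine ⟨max C (∑ j ∈ Finset.range K₀, |m j|), fun k => ?_⟩
  by_cases hk : K₀ ≤ k
  · exact (hK₀ k hk).trans (le_max_left _ _)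
  · push Not at hk
    exact (Finset.single_le_sum (f := fun j => |m j|) (fun j _ => abs_nonneg _)
      (Finset.mem_range.2 hk)).trans (le_max_right _ _)

/-! ## The plane-field one-point function (single-plane tuples: `fieldP_single`, `normP_single`) -/

section Lattice

variable {G : Type} [Group G] [TopologicalSpace G] [IsTopologicalGroup G] [CompactSpace G]
  [MeasurableSpace G] [BorelSpace G]

/-- **The plane-field one-point function as a sum**:
`∫ Φ^{q}_k(f) dμ_k = c_k a_k⁴ Σₓ f(a_k x) ∫ (W(τ₋ₓ Ũ) − m_k/6) dμ_k`. [folklore] -/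
theorem integral_planeField_eq (r : LatticeRep G) (sch : SpeciesScheme (YMSpecies G)) (k : ℕ)
    (q : Plane) (f : 𝓢(EuclideanSpace ℝ (Fin 4), ℝ)) :
    ∫ U, planeField r sch k q f U ∂(wilsonAt r sch k) =
      sch.c r.curvature k * sch.a k ^ 4 *
        ∑ x ∈ box 4 (sch.L k), f (sch.a k • siteToE x) *
          ∫ U, ((planeSpecies r q).F (configShift (-x) (torusLift (sch.side k) U)) -
            sch.m r.curvature k / 6) ∂(wilsonAt r sch k) := by
  -- adapted from `CurvatureKernel.latticeSchwinger_one_eq`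
  have hI : ∀ x, Integrable
      (fun U : GaugeConfig 4 (sch.side k) G =>
        (planeSpecies r q).F (configShift (-x) (torusLift (sch.side k) U)) - sch.m r.curvature k / 6)
      (wilsonAt r sch k) := fun x =>
    integrable_shift_lift r.ρ r.continuous _ _ (planeSpecies r q).measurable (planeSpecies r q).bounded
      x _
  unfold planeField smearedLatticeField
  rw [integral_const_mul, integral_finsetSum _ fun x _ => (hI x).const_mul _]
  congr 1
  refine Finset.sum_congr rfl fun x _ => ?_
  rw [integral_const_mul]

/-- **UMBP at `n = 1` on one plane**: `|∫ Φ^{q}_k(f) dμ_k| ≤ C₀ C₁` for `|f|_s ≤ 1`. [folklore] -/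
theorem abs_integral_planeField_le (r : LatticeRep G) (sch : SpeciesScheme (YMSpecies G)) {s : ℕ}
    {C₀ C₁ : ℝ}
    (hU : ∀ (n : ℕ) (F : Fin n → Plane → 𝓢(EuclideanSpace ℝ (Fin 4), ℝ)),
      (∀ i, normP s (F i) ≤ 1) → (∀ i j, i ≠ j → DisjP (F i) (F j)) →
        ∀ k : ℕ, |∫ U, ∏ i, fieldP r sch k (F i) U ∂(wilsonAt r sch k)| ≤ C₀ * C₁ ^ n * n.factorial)
    (q : Plane) {f : 𝓢(EuclideanSpace ℝ (Fin 4), ℝ)} (hf : schwartzNorm s (ofRealTest f) ≤ 1)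
    (k : ℕ) : |∫ U, planeField r sch k q f U ∂(wilsonAt r sch k)| ≤ C₀ * C₁ := by
  have h := hU 1 (fun _ => Pi.single q f) (fun _ => by rw [normP_single]; exact hf)
    (fun i j hij => absurd (Subsingleton.elim i j) hij) k
  simpa only [Fin.prod_univ_one, fieldP_single, pow_one, Nat.factorial_one, Nat.cast_one,
    mul_one] using h

/-- **The one-step counterterm inequality.** If `|W| ≤ B_w` for the plane species, `f ≥ 0` and
`|∫ Φ^{q}_k(f) dμ_k| ≤ K`, then `|c_k| · (a_k⁴ Σₓ f(a_k x)) · (|m_k/6| − B_w) ≤ K`. [folklore] -/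
theorem abs_c_mul_riemann_mul_sub_le (r : LatticeRep G) (sch : SpeciesScheme (YMSpecies G))
    (q : Plane) {Bw : ℝ} (hBw : ∀ U, |(planeSpecies r q).F U| ≤ Bw)
    {f : 𝓢(EuclideanSpace ℝ (Fin 4), ℝ)} (hf0 : ∀ y, 0 ≤ f y) (k : ℕ) {K : ℝ}
    (hK : |∫ U, planeField r sch k q f U ∂(wilsonAt r sch k)| ≤ K) :
    |sch.c r.curvature k| * (sch.a k ^ 4 * ∑ x ∈ box 4 (sch.L k), f (sch.a k • siteToE x)) *
      (|sch.m r.curvature k / 6| - Bw) ≤ K := by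
  haveI : IsProbabilityMeasure (wilsonAt r sch k) :=
    isProbabilityMeasure_wilsonMeasure (d := 4) (L := sch.side k) r.ρ r.continuous (sch.β k)
  set M : ℝ := sch.m r.curvature k / 6 with hM
  set ξ : Site 4 → ℝ := fun x =>
    ∫ U, ((planeSpecies r q).F (configShift (-x) (torusLift (sch.side k) U)) - M)
      ∂(wilsonAt r sch k) with hξ_def
  have hξ : ∀ x ∈ box 4 (sch.L k), |ξ x + M| ≤ Bw := fun x _ => by
    have hI : Integrable (fun U : GaugeConfig 4 (sch.side k) G =>
        (planeSpecies r q).F (configShift (-x) (torusLift (sch.side k) U)) - M) (wilsonAt r sch k) :=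
      integrable_shift_lift r.ρ r.continuous _ _ (planeSpecies r q).measurable
        (planeSpecies r q).bounded x _
    have heq : ξ x + M = ∫ U, ((planeSpecies r q).F (configShift (-x) (torusLift (sch.side k) U))
        - M + M) ∂(wilsonAt r sch k) := by
      rw [integral_add hI (integrable_const M), integral_const, probReal_univ, one_smul]
    rw [heq]
    exact abs_integral_le_of_abs_le fun U => by rw [sub_add_cancel]; exact hBw _
  have h1 := sub_mul_sum_le_abs_sum_mul (box 4 (sch.L k)) (fun x => f (sch.a k • siteToE x)) ξ M Bw
    (fun x _ => hf0 _) hξ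
  rw [integral_planeField_eq, abs_mul, abs_mul, abs_of_nonneg (by positivity : (0 : ℝ) ≤ sch.a k ^ 4)]
    at hK
  calc |sch.c r.curvature k| * (sch.a k ^ 4 * ∑ x ∈ box 4 (sch.L k), f (sch.a k • siteToE x)) *
        (|M| - Bw)
      = |sch.c r.curvature k| * sch.a k ^ 4 *
          ((|M| - Bw) * ∑ x ∈ box 4 (sch.L k), f (sch.a k • siteToE x)) := by ring
    _ ≤ |sch.c r.curvature k| * sch.a k ^ 4 *
          |∑ x ∈ box 4 (sch.L k), f (sch.a k • siteToE x) * ξ x| :=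
        mul_le_mul_of_nonneg_left h1 (by positivity)
    _ ≤ K := hK

end Lattice

/-! ## The stub -/

/-- **M · `stub_countertermBound` (line `Sketch`, r11).** The `k`-uniform plane-resolved moment bound
at `n = 1` and the non-triviality floor force bounded additive counterterms of the curvature:
`∃ Cm, ∀ k, |m_k| ≤ Cm` (NT pins `|c_k| ≥ c₀ > 0` eventually through the truncated two-point bound;
UMBP at `n = 1` on a non-negative plateau bump pins `|c_k| (|m_k|/6 − B_w) ≤ 16 C₀C₁/t`). [folklore] -/
theorem stub_countertermBound :
    ∀ (G : Type) [Group G] [TopologicalSpace G] [IsTopologicalGroup G] [CompactSpace G]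
      [MeasurableSpace G] [BorelSpace G] (r : LatticeRep G) (sch : SpeciesScheme (YMSpecies G)),
      UniformMomentBoundsPlanes r sch →
      (∃ (u v : 𝓢(EuclideanSpace ℝ (Fin 4), ℝ)) (δ : ℝ), 0 < δ ∧
          ∀ᶠ k in atTop, δ ≤
            |latticeSchwinger r.ρ sch (fun s => s.F) k (1 + 1) (fun _ => r.curvature) ![u, v] -
              latticeSchwinger r.ρ sch (fun s => s.F) k 1 (fun _ => r.curvature) ![u] *
                latticeSchwinger r.ρ sch (fun s => s.F) k 1 (fun _ => r.curvature) ![v]|) →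
      ∃ Cm : ℝ, ∀ k, |sch.m r.curvature k| ≤ Cm := by
  intro G _ _ _ _ _ _ r sch hU hNT
  obtain ⟨s, C₀, C₁, hU⟩ := hU
  obtain ⟨u, v, δ, hδ, hNT⟩ := hNT
  -- the normalised plateau bump `f = t • f₀`
  obtain ⟨f₀, hf₀0, -, hf₀1, -, -⟩ := exists_bump_schwartz (0 : EuclideanSpace ℝ (Fin 4)) one_pos
  have hN₀ : 0 ≤ schwartzNorm s (ofRealTest f₀) := schwartzNorm_nonneg _ _
  set t : ℝ := 1 / (1 + schwartzNorm s (ofRealTest f₀)) with ht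
  have ht0 : 0 < t := by positivity
  set f : 𝓢(EuclideanSpace ℝ (Fin 4), ℝ) := t • f₀ with hf
  have hf_apply : ∀ y, f y = t * f₀ y := fun y => by rw [hf, smul_apply, smul_eq_mul]
  have hf0 : ∀ y, 0 ≤ f y := fun y => by rw [hf_apply]; exact mul_nonneg ht0.le (hf₀0 y)
  have hfnorm : schwartzNorm s (ofRealTest f) ≤ 1 := by
    rw [hf, schwartzNorm_ofRealTest_smul, abs_of_pos ht0, ht, div_mul_eq_mul_div, one_mul,
      div_le_one (by positivity)]
    linarith
  -- constants
  set q₀ : Plane := ⟨(0, 1), by decide⟩ with hq₀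
  obtain ⟨Bw, hBw⟩ := (planeSpecies r q₀).bounded
  obtain ⟨Bc, hBc⟩ := r.curvature.bounded
  obtain ⟨Cu, hCu0, hCu⟩ := exists_latticeSum_le (d := 4) u
  obtain ⟨Cv, hCv0, hCv⟩ := exists_latticeSum_le (d := 4) v
  have hP : ∀ k, |∫ U, planeField r sch k q₀ f U ∂(wilsonAt r sch k)| ≤ C₀ * C₁ := fun k =>
    abs_integral_planeField_le r sch hU q₀ hfnorm k
  have hCC : 0 ≤ C₀ * C₁ := (abs_nonneg _).trans (hP 0)
  have hkey : ∀ k, |sch.c r.curvature k| *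
      (sch.a k ^ 4 * ∑ x ∈ box 4 (sch.L k), f (sch.a k • siteToE x)) *
        (|sch.m r.curvature k / 6| - Bw) ≤ C₀ * C₁ := fun k =>
    abs_c_mul_riemann_mul_sub_le r sch q₀ hBw hf0 k (hP k)
  -- eventual smallness of the mesh and largeness of the box
  have hev_a : ∀ᶠ k in atTop, sch.a k ≤ 1 / 2 :=
    sch.tendsto_a.eventually (eventually_le_nhds (by norm_num))
  have hev_aL : ∀ᶠ k in atTop, (1 : ℝ) ≤ sch.a k * sch.L k :=
    sch.tendsto_L.eventually (eventually_ge_atTop 1)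
  -- (1) NT: `δ ≤ c_k² D` eventually
  set D : ℝ := (2 * Bc) ^ 2 * Cu * Cv with hD_def
  have hevD : ∀ᶠ k in atTop, δ ≤ sch.c r.curvature k ^ 2 * D := by
    filter_upwards [hNT, hev_a] with k hk ha
    have ha1 : sch.a k ≤ 1 := ha.trans (by norm_num)
    have h2 := LatticeTruncatedTwoPointBound G r sch r.curvature Bc hBc k ![u, v]
    have eu : (fun _ : Fin 1 => (![u, v] : Fin 2 → 𝓢(EuclideanSpace ℝ (Fin 4), ℝ)) 0) = ![u] :=
      funext fun i => by fin_cases i; rfl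
    have ev : (fun _ : Fin 1 => (![u, v] : Fin 2 → 𝓢(EuclideanSpace ℝ (Fin 4), ℝ)) 1) = ![v] :=
      funext fun i => by fin_cases i; rfl
    rw [eu, ev] at h2
    simp only [Matrix.cons_val_zero, Matrix.cons_val_one] at h2
    have hRu := hCu (sch.a k) (sch.a_pos k) ha1 (sch.L k)
    have hRv := hCv (sch.a k) (sch.a_pos k) ha1 (sch.L k)
    have h0 : 0 ≤ sch.c r.curvature k ^ 2 * (2 * Bc) ^ 2 := by positivity
    have hRv0 : 0 ≤ sch.a k ^ 4 * ∑ x ∈ box 4 (sch.L k), |v (sch.a k • siteToE x)| := by positivity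
    calc δ ≤ _ := hk
      _ ≤ _ := h2
      _ ≤ sch.c r.curvature k ^ 2 * (2 * Bc) ^ 2 * Cu *
            (sch.a k ^ 4 * ∑ x ∈ box 4 (sch.L k), |v (sch.a k • siteToE x)|) :=
          mul_le_mul_of_nonneg_right (mul_le_mul_of_nonneg_left hRu h0) hRv0
      _ ≤ sch.c r.curvature k ^ 2 * (2 * Bc) ^ 2 * Cu * Cv :=
          mul_le_mul_of_nonneg_left hRv (mul_nonneg h0 hCu0)
      _ = sch.c r.curvature k ^ 2 * D := by rw [hD_def]; ring
  have hD : 0 < D := by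
    obtain ⟨k, hk⟩ := hevD.exists
    by_contra h
    push Not at h
    have : sch.c r.curvature k ^ 2 * D ≤ 0 := mul_nonpos_of_nonneg_of_nonpos (sq_nonneg _) h
    linarith
  set c₀ : ℝ := Real.sqrt (δ / D) with hc₀_def
  have hc₀ : 0 < c₀ := Real.sqrt_pos.2 (div_pos hδ hD)
  -- (4) the Riemann mass of the plateau: `R_k ≥ t / 16` eventually
  have hevR : ∀ᶠ k in atTop,
      t / 16 ≤ sch.a k ^ 4 * ∑ x ∈ box 4 (sch.L k), f (sch.a k • siteToE x) := by
    filter_upwards [hev_a, hev_aL] with k ha haL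
    have hak := sch.a_pos k
    have hpl : (1 / (2 * sch.a k)) ^ 4 ≤ ∑ y ∈ box 4 (sch.L k), f₀ (sch.a k • siteToE y) :=
      pow_le_sum_box (g := ⇑f₀) (p := 0) (ρ := 1) hf₀0 hak (fun z hz => hf₀1 z hz) (by linarith)
        fun j => by simpa using haL
    have h16 : sch.a k ^ 4 * (1 / (2 * sch.a k)) ^ 4 = 1 / 16 := by
      field_simp
      ring
    have hsum : sch.a k ^ 4 * ∑ x ∈ box 4 (sch.L k), f (sch.a k • siteToE x) =
        t * (sch.a k ^ 4 * ∑ x ∈ box 4 (sch.L k), f₀ (sch.a k • siteToE x)) := by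
      rw [Finset.mul_sum, Finset.mul_sum, Finset.mul_sum]
      refine Finset.sum_congr rfl fun x _ => ?_
      rw [hf_apply]; ring
    rw [hsum]
    calc t / 16 = t * (sch.a k ^ 4 * (1 / (2 * sch.a k)) ^ 4) := by rw [h16]; ring
      _ ≤ t * (sch.a k ^ 4 * ∑ y ∈ box 4 (sch.L k), f₀ (sch.a k • siteToE y)) :=
          mul_le_mul_of_nonneg_left (mul_le_mul_of_nonneg_left hpl (by positivity)) ht0.le
  -- (5) the eventual bound on the counterterm
  set x₀ : ℝ := c₀ * (t / 16) with hx₀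
  have hx₀pos : 0 < x₀ := by positivity
  have hevM : ∀ᶠ k in atTop, |sch.m r.curvature k| ≤ 6 * (Bw + C₀ * C₁ / x₀) := by
    filter_upwards [hevD, hevR] with k hkD hkR
    have hc : c₀ ≤ |sch.c r.curvature k| := by
      rw [hc₀_def]
      calc Real.sqrt (δ / D) ≤ Real.sqrt (sch.c r.curvature k ^ 2) :=
            Real.sqrt_le_sqrt (by rw [div_le_iff₀ hD]; exact hkD)
        _ = |sch.c r.curvature k| := Real.sqrt_sq_eq_abs _
    have hX : x₀ ≤ |sch.c r.curvature k| *
        (sch.a k ^ 4 * ∑ x ∈ box 4 (sch.L k), f (sch.a k • siteToE x)) :=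
      mul_le_mul hc hkR (by positivity) (abs_nonneg _)
    have hk := hkey k
    have hMB : |sch.m r.curvature k / 6| - Bw ≤ C₀ * C₁ / x₀ := by
      by_cases hle : |sch.m r.curvature k / 6| - Bw ≤ 0
      · exact hle.trans (div_nonneg hCC hx₀pos.le)
      · push Not at hle
        rw [le_div_iff₀ hx₀pos]
        calc (|sch.m r.curvature k / 6| - Bw) * x₀
            ≤ (|sch.m r.curvature k / 6| - Bw) * (|sch.c r.curvature k| *
                (sch.a k ^ 4 * ∑ x ∈ box 4 (sch.L k), f (sch.a k • siteToE x))) :=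
              mul_le_mul_of_nonneg_left hX hle.le
          _ = |sch.c r.curvature k| *
                (sch.a k ^ 4 * ∑ x ∈ box 4 (sch.L k), f (sch.a k • siteToE x)) *
                  (|sch.m r.curvature k / 6| - Bw) := by ring
          _ ≤ C₀ * C₁ := hk
    rw [abs_div, abs_of_pos (by norm_num : (0 : ℝ) < 6)] at hMB
    linarith
  exact exists_forall_abs_le_of_eventually hevM

end Summit.QuantumFields.YangMills.Theorems.WeakCouplingHypercubicLimit.TraceNormColdPressure

end
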